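import Literature.Analysis.FluidPDE.BiotSavartCurlPair
import Literature.Analysis.FluidPDE.BiotSavartBounds
import Literature.Analysis.FluidPDE.LocalBiotSavartCalculus
import Literature.Analysis.FluidPDE.BiotSavartGradient
import Literature.Analysis.FluidPDE.NewtonPotentialHolder
import HarnessLib

/-!
# A local Helmholtz identity and a sup bound for `v − K ∗ b` when `curl v = a + b`, `|a| ≤ Λ`

Analysis/FluidPDE proof file (theorems only), a brick of the discharge of
`Literature.Analysis.FluidPDE.constantin_fefferman` (`NSVorticity.lean`). In the Constantin–Fefferman
estimate the stretching of the high vorticity `ω_hi` by the velocity `u_lo = v − K ∗ ω_hi`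
generated by the *low* vorticity is integrated by parts, which requires a sup bound for `u_lo`
(Lemarié-Rieusset 2016, proof of Thm. 11.7, the terms with `α = 1_{|ω|≤R} ω`; Constantin–Fefferman
1993, §2). We prove, for a `C²` divergence-free field `v ∈ L²(ℝ³)` whose curl is split as
`curl v = a + b` with `a` bounded by `Λ` and `b` continuous with compact support:

* `curl_curl_eq_sum_fderiv_divergence_sub_laplacian` — `curl curl W = ∇(div W) − ΔW` for
  `W ∈ C²(ℝ³; ℝ³)` (coordinates; the divergence-free case is the tree's
  `curl_curl_eq_neg_laplacian`);
* `eq_biotSavart_curl_smul_add` — **the local Helmholtz identity at a point**: with the smooth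
  cutoff `φ = suppCutoff x 1` (`= 1` on `B̄(x,1)`, `= 0` off `B(x,2)`),
  `v(x) = (K ∗ curl(φv))(x) + ∑ⱼ (∫ ∂ⱼΓ(x − y) ⟪v(y), ∇φ(y)⟫ dy) eⱼ`
  (`K ∗ Φ = −Γ ∗ curl Φ` for test fields, `biotSavart_eq_neg_integral_newtonKernel_smul_curl`;
  `curl curl = ∇div − Δ`; Green's representation `Γ ∗ ΔW = W` and the weak gradient of `Γ`,
  `integral_newtonKernel_mul_laplacian`, `integral_newtonKernel_smul_fderiv_eq`; `div v = 0`);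
* `exists_norm_sub_biotSavart_le` — **the sup bound**: there are absolute constants `C_b, C_v`
  with `‖v(x) − (K ∗ b)(x)‖ ≤ 2Λ + C_b ‖b‖_{L²} + C_v ‖v‖_{L²}` for all `x`
  (`curl(φv) = φa + φb + ∇φ × v`; the near field of `φa` costs `Λ (4π)⁻¹ ∫_{|z|<2}|z|⁻² = 2Λ`,
  the far field `(φ − 1)b` is Cauchy–Schwarz against `1_{|z|≥1}|z|⁻² ∈ L²`, and the cutoff terms
  live on the shell `1 ≤ |x − y| ≤ 2` where all kernels are bounded).

## References

* P. Constantin, C. Fefferman, Indiana Univ. Math. J. 42 (1993), §2. [ConstantinFeffermanIndiana1993]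
* P. G. Lemarié-Rieusset, *The Navier–Stokes Problem in the 21st Century* (2016), Thm. 11.7
  (proof, PDF pp. 370–371). [LemarieRieusset2016]
* A. J. Majda, A. L. Bertozzi, *Vorticity and Incompressible Flow* (2002), §2.4.1 (2.92)–(2.95).
* D. Gilbarg, N. S. Trudinger (2001), (2.17), Lemma 4.1.
-/

noncomputable section

open MeasureTheory Set Function Filter Metric Real InnerProductSpace
open _root_.Topology
open scoped ENNReal NNReal RealInnerProductSpace Laplacian ContDiff

namespace Literature.Analysis.FluidPDE

/-! ### `curl curl = ∇ div − Δ` -/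

section CurlCurl

/-- **`curl (curl W) = ∇(div W) − ΔW`** for `W ∈ C²(ℝ³; ℝ³)`, the gradient of the divergence
written in coordinates `∑ᵢ ∂ᵢ(div W) eᵢ` (Majda–Bertozzi, §2.4.1; the divergence-free case is the
tree's `curl_curl_eq_neg_laplacian`). Proof in coordinates through the symmetric `B = D²W(y)`:
`(∇ div W)ᵢ = Σₘ (B eᵢ eₘ)ₘ`, `(ΔW)ᵢ = Σⱼ (B eⱼ eⱼ)ᵢ`. [cite: MajdaBertozziCUP2002, §2.4.1 Prop. 2.16 (proof: curl curl ψ = ∇ div ψ − Δψ)] -/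
theorem curl_curl_eq_sum_fderiv_divergence_sub_laplacian {W : (EuclideanSpace ℝ (Fin 3)) → (EuclideanSpace ℝ (Fin 3))} (hW : ContDiff ℝ 2 W)
    (y : (EuclideanSpace ℝ (Fin 3))) :
    curl (curl W) y =
      (∑ i, (fderiv ℝ (VectorCalculus.divergence W) y (EuclideanSpace.single (i : Fin 3) (1 : ℝ))) • (EuclideanSpace.single (i : Fin 3) (1 : ℝ))) - (Δ W) y := by
  set B := fderiv ℝ (fderiv ℝ W) y with hB
  have hs : ∀ a c : (EuclideanSpace ℝ (Fin 3)), B a c = B c a := fun a c =>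
    (hW.contDiffAt.isSymmSndFDerivAt (n := 2) (by simp)) a c
  have hs' : ∀ j k i : Fin 3, B (EuclideanSpace.single (j : Fin 3) (1 : ℝ)) (EuclideanSpace.single (k : Fin 3) (1 : ℝ)) i = B (EuclideanSpace.single (k : Fin 3) (1 : ℝ)) (EuclideanSpace.single (j : Fin 3) (1 : ℝ)) i := fun j k i => by rw [hs]
  have h1 : curl (curl W) y = curlCLM (curlCLM.comp B) := by
    rw [curl_eq_curlCLM, fderiv_curl hW]
  have h2 : (Δ W) y = ∑ j, B (EuclideanSpace.single (j : Fin 3) (1 : ℝ)) (EuclideanSpace.single (j : Fin 3) (1 : ℝ)) := by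
    rw [laplacian_eq_sum_fderiv_fderiv (EuclideanSpace.basisFun (Fin 3) ℝ) hW y]
    refine Finset.sum_congr rfl fun j _ => ?_
    rw [fderiv_fderiv_apply_eq hW]
    simp [hB]
  have h3 : ∀ i : Fin 3, fderiv ℝ (VectorCalculus.divergence W) y (EuclideanSpace.single (i : Fin 3) (1 : ℝ)) =
      B (EuclideanSpace.single (i : Fin 3) (1 : ℝ)) (EuclideanSpace.single (0 : Fin 3) (1 : ℝ)) 0 + B (EuclideanSpace.single (i : Fin 3) (1 : ℝ)) (EuclideanSpace.single (1 : Fin 3) (1 : ℝ)) 1 + B (EuclideanSpace.single (i : Fin 3) (1 : ℝ)) (EuclideanSpace.single (2 : Fin 3) (1 : ℝ)) 2 := fun i => by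
    rw [fderiv_divergence_apply hW, traceCLM_apply, trace_eq_sum_coord, Fin.sum_univ_three]
  rw [h1, h2]
  ext i
  fin_cases i <;>
    simp [curlCLM_apply, Fin.sum_univ_three, h3] <;>
    linarith [hs' 0 1 0, hs' 0 1 1, hs' 0 1 2, hs' 0 2 0, hs' 0 2 1, hs' 0 2 2,
      hs' 1 2 0, hs' 1 2 1, hs' 1 2 2]

end CurlCurl

/-! ### The local Helmholtz identity at a point -/

section Representation

variable {v : (EuclideanSpace ℝ (Fin 3)) → (EuclideanSpace ℝ (Fin 3))}

/-- The cutoff `φ = suppCutoff x 1` is `C^n`. [folklore] -/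
theorem contDiff_suppCutoff' (x : (EuclideanSpace ℝ (Fin 3))) {n : ℕ} : ContDiff ℝ n (suppCutoff x 1) :=
  contDiff_suppCutoff x 1 (n := n)

/-- The gradient of the cutoff is `C¹` with compact support in `B̄(x, 2)`. [folklore] -/
theorem contDiff_gradient_suppCutoff (x : (EuclideanSpace ℝ (Fin 3))) : ContDiff ℝ 1 (gradient (suppCutoff x 1)) :=
  (InnerProductSpace.toDual ℝ (EuclideanSpace ℝ (Fin 3))).symm.contDiff.comp
    ((contDiff_suppCutoff' x (n := 2)).fderiv_right (m := 1) (by norm_cast))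

/-- The gradient of the cutoff has compact support. [folklore] -/
theorem hasCompactSupport_gradient_suppCutoff (x : (EuclideanSpace ℝ (Fin 3))) :
    HasCompactSupport (gradient (suppCutoff x 1)) :=
  ((hasCompactSupport_suppCutoff x one_pos).fderiv (𝕜 := ℝ)).comp_left
    (g := (InnerProductSpace.toDual ℝ (EuclideanSpace ℝ (Fin 3))).symm) (map_zero _)

/-- **Green's representation for vector fields**: `∫ Γ(x − y) ΔW(y) dy = W(x)` for
`W ∈ C²_c(ℝ³; ℝ³)` (componentwise from the tree's scalar `integral_newtonKernel_mul_laplacian`). [cite: GilbargTrudinger2001, (2.17)] -/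
theorem integral_newtonKernel_smul_laplacian {W : (EuclideanSpace ℝ (Fin 3)) → (EuclideanSpace ℝ (Fin 3))} (hW : ContDiff ℝ 2 W)
    (hWc : HasCompactSupport W) (x : (EuclideanSpace ℝ (Fin 3))) : ∫ y, newtonKernel (x - y) • (Δ W) y = W x := by
  have hΔc : Continuous (Δ W) := (contDiff_laplacian (n := 0) (by exact hW)).continuous
  have hΔs : HasCompactSupport (Δ W) :=
    HasCompactSupport.of_support_subset_isCompact hWc.isCompact fun y hy => by
      by_contra h
      exact hy (laplacian_eq_zero_of_notMem_tsupport h)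
  have hint : Integrable fun y => newtonKernel (x - y) • (Δ W) y :=
    integrable_newtonKernel_smul hΔc hΔs x
  ext i
  set prj : (EuclideanSpace ℝ (Fin 3)) →L[ℝ] ℝ := EuclideanSpace.proj i with hprj
  have hπapp : ∀ z : (EuclideanSpace ℝ (Fin 3)), prj z = z i := fun z => rfl
  have hcomp : (fun z => W z i) = prj ∘ W := rfl
  have hWi : ContDiff ℝ 2 fun z => W z i := by rw [hcomp]; exact prj.contDiff.comp hW
  have hWic : HasCompactSupport fun z => W z i := by rw [hcomp]; exact hWc.comp_left (map_zero _)
  have hcoord : ∀ y, (Δ W) y i = (Δ fun z => W z i) y := fun y => by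
    rw [hcomp, ContDiffAt.laplacian_CLM_comp_left hW.contDiffAt]
    rfl
  calc (∫ y, newtonKernel (x - y) • (Δ W) y) i = prj (∫ y, newtonKernel (x - y) • (Δ W) y) := rfl
    _ = ∫ y, prj (newtonKernel (x - y) • (Δ W) y) := (prj.integral_comp_comm hint).symm
    _ = ∫ y, newtonKernel (x - y) * (Δ fun z => W z i) y := by
        refine integral_congr_ae (Eventually.of_forall fun y => ?_)
        show prj (newtonKernel (x - y) • (Δ W) y) = newtonKernel (x - y) * (Δ fun z => W z i) y
        rw [map_smul, hπapp, hcoord, smul_eq_mul]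
    _ = W x i := integral_newtonKernel_mul_laplacian hWi hWic x

/-- **The local Helmholtz identity at a point.** For a `C²` divergence-free field `v` and the
smooth cutoff `φ = suppCutoff x 1` (`= 1` on `B̄(x, 1)`, supported in `B̄(x, 2)`):
`v(x) = (K ∗ curl(φv))(x) + ∑ⱼ (∫ ∂ⱼΓ(x − y) ⟪v(y), ∇φ(y)⟫ dy) eⱼ`. Proof: `K ∗ Φ = −Γ ∗ curl Φ`
for `Φ = curl(φv)` (`biotSavart_eq_neg_integral_newtonKernel_smul_curl`), `curl curl = ∇ div − Δ`,
Green's representation `Γ ∗ Δ(φv) = φv`, the weak gradient of `Γ`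
(`integral_newtonKernel_smul_fderiv_eq`) and `div(φv) = ⟪v, ∇φ⟫` (`div v = 0`) — the Helmholtz
decomposition of the compactly supported field `φv` (Majda–Bertozzi §2.4.1) read off at the centre
of the cutoff. [cite: MajdaBertozziCUP2002, §2.4.1 Prop. 2.16 (2.92)–(2.95)] -/
theorem eq_biotSavart_curl_smul_add (hv : ContDiff ℝ 2 v) (hdiv : VectorCalculus.IsDivFree v)
    (x : (EuclideanSpace ℝ (Fin 3))) :
    v x = biotSavart (curl fun y => suppCutoff x 1 y • v y) x +
      ∑ j, (∫ y, fderiv ℝ newtonKernel (x - y) (EuclideanSpace.single (j : Fin 3) (1 : ℝ)) *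
        ⟪v y, gradient (suppCutoff x 1) y⟫) • (EuclideanSpace.single (j : Fin 3) (1 : ℝ)) := by
  -- the localised field `W = φ v` and its companions
  set φ : (EuclideanSpace ℝ (Fin 3)) → ℝ := suppCutoff x 1 with hφdef
  have hφ2 : ContDiff ℝ 2 φ := contDiff_suppCutoff' x
  have hφc : HasCompactSupport φ := hasCompactSupport_suppCutoff x one_pos
  set W : (EuclideanSpace ℝ (Fin 3)) → (EuclideanSpace ℝ (Fin 3)) := fun y => φ y • v y with hWdef
  have hW : ContDiff ℝ 2 W := hφ2.smul hv
  have hWc : HasCompactSupport W := hφc.smul_right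
  have hcW : ContDiff ℝ 1 (curl W) := contDiff_curl (n := 1) (by exact hW)
  have hcWc : HasCompactSupport (curl W) := hasCompactSupport_curl hWc
  have hccWc : HasCompactSupport (curl (curl W)) := hasCompactSupport_curl hcWc
  have hccW : Continuous (curl (curl W)) := continuous_curl hcW
  -- `div W = ⟪v, ∇φ⟫`
  set f : (EuclideanSpace ℝ (Fin 3)) → ℝ := fun y => ⟪v y, gradient φ y⟫ with hfdef
  have hdivW : VectorCalculus.divergence W = f := by
    funext y
    rw [hWdef, divergence_smul_apply (hφ2.differentiable (by norm_num) y)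
      (hv.differentiable (by norm_num) y), hdiv y, mul_zero, zero_add]
  have hv1 : ContDiff ℝ 1 v := hv.of_le (by norm_num)
  have hf1 : ContDiff ℝ 1 f := ContDiff.inner ℝ hv1 (contDiff_gradient_suppCutoff x)
  have hfc : HasCompactSupport f := by
    refine (hasCompactSupport_gradient_suppCutoff x).mono ?_
    intro y hy
    rw [mem_support] at hy ⊢
    intro h
    have h' : gradient φ y = 0 := by rw [hφdef]; exact h
    exact hy (show ⟪v y, gradient φ y⟫ = 0 by rw [h', inner_zero_right])
  -- the Laplacian
  have hΔc : Continuous (Δ W) := (contDiff_laplacian (n := 0) (by exact hW)).continuous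
  have hΔs : HasCompactSupport (Δ W) :=
    HasCompactSupport.of_support_subset_isCompact hWc.isCompact fun y hy => by
      by_contra h
      exact hy (laplacian_eq_zero_of_notMem_tsupport h)
  -- `curl curl W = G − ΔW`, `G = ∑ᵢ ∂ᵢ f eᵢ`
  set G : (EuclideanSpace ℝ (Fin 3)) → (EuclideanSpace ℝ (Fin 3)) := fun y => ∑ i, (fderiv ℝ f y (EuclideanSpace.single (i : Fin 3) (1 : ℝ))) • (EuclideanSpace.single (i : Fin 3) (1 : ℝ)) with hGdef
  have hccW_eq : ∀ y, curl (curl W) y = G y - (Δ W) y := fun y => by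
    rw [curl_curl_eq_sum_fderiv_divergence_sub_laplacian hW y, hdivW]
  -- integrability against `Γ(x − ·)`
  have IΔ : Integrable fun y => newtonKernel (x - y) • (Δ W) y :=
    integrable_newtonKernel_smul hΔc hΔs x
  have Icc : Integrable fun y => newtonKernel (x - y) • curl (curl W) y :=
    integrable_newtonKernel_smul hccW hccWc x
  have IG : Integrable fun y => newtonKernel (x - y) • G y := by
    have h := Icc.add IΔ
    refine h.congr (Eventually.of_forall fun y => ?_)
    show newtonKernel (x - y) • curl (curl W) y + newtonKernel (x - y) • (Δ W) y = _
    rw [hccW_eq, smul_sub, sub_add_cancel]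
  have Ii : ∀ i : Fin 3, Integrable fun y => newtonKernel (x - y) * fderiv ℝ f y (EuclideanSpace.single (i : Fin 3) (1 : ℝ)) := fun i => by
    have h := integrable_newtonKernel_smul (F := ℝ)
      ((hf1.continuous_fderiv one_ne_zero).clm_apply continuous_const)
      (hfc.fderiv_apply (𝕜 := ℝ) (EuclideanSpace.single (i : Fin 3) (1 : ℝ))) x
    simpa only [smul_eq_mul] using h
  -- `∫ Γ • G = ∑ⱼ (∫ ∂ⱼΓ(x − y) f(y)) eⱼ`
  have hG : ∫ y, newtonKernel (x - y) • G y =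
      ∑ j, (∫ y, fderiv ℝ newtonKernel (x - y) (EuclideanSpace.single (j : Fin 3) (1 : ℝ)) * f y) • (EuclideanSpace.single (j : Fin 3) (1 : ℝ)) := by
    have hexp : (fun y => newtonKernel (x - y) • G y) =
        fun y => ∑ j, (newtonKernel (x - y) * fderiv ℝ f y (EuclideanSpace.single (j : Fin 3) (1 : ℝ))) • (EuclideanSpace.single (j : Fin 3) (1 : ℝ)) := by
      funext y
      rw [hGdef, Finset.smul_sum]
      refine Finset.sum_congr rfl fun j _ => ?_
      rw [smul_smul]
    rw [hexp, integral_finsetSum _ fun j _ => (Ii j).smul_const _]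
    refine Finset.sum_congr rfl fun j _ => ?_
    rw [integral_smul_const]
    congr 1
    have h := integral_newtonKernel_smul_fderiv_eq (F := ℝ) hf1 hfc x (EuclideanSpace.single (j : Fin 3) (1 : ℝ))
    simpa only [smul_eq_mul] using h
  -- Green
  have hGreen : ∫ y, newtonKernel (x - y) • (Δ W) y = v x := by
    rw [integral_newtonKernel_smul_laplacian hW hWc x, hWdef]
    simp only [hφdef, suppCutoff_eq_one one_pos (by rw [sub_self, norm_zero]; norm_num : ‖x - x‖ ≤ 1),
      one_smul]
  -- assemble
  have h1 := biotSavart_eq_neg_integral_newtonKernel_smul_curl hcW hcWc x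
  have h2 : ∫ y, newtonKernel (x - y) • curl (curl W) y =
      (∫ y, newtonKernel (x - y) • G y) - ∫ y, newtonKernel (x - y) • (Δ W) y := by
    rw [← integral_sub IG IΔ]
    refine integral_congr_ae (Eventually.of_forall fun y => ?_)
    show newtonKernel (x - y) • curl (curl W) y =
      newtonKernel (x - y) • G y - newtonKernel (x - y) • (Δ W) y
    rw [hccW_eq, smul_sub]
  rw [h1, h2, hGreen, hG]
  abel

end Representation

/-! ### Tools for the bounds -/

section Tools

/-- `0 ≤ φ`. [folklore] -/
theorem suppCutoff_nonneg (x₀ : (EuclideanSpace ℝ (Fin 3))) (ρ : ℝ) (y : (EuclideanSpace ℝ (Fin 3))) : 0 ≤ suppCutoff x₀ ρ y :=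
  radialCutoff_nonneg _ _ _

/-- `φ ≤ 1`. [folklore] -/
theorem suppCutoff_le_one (x₀ : (EuclideanSpace ℝ (Fin 3))) (ρ : ℝ) (y : (EuclideanSpace ℝ (Fin 3))) : suppCutoff x₀ ρ y ≤ 1 :=
  radialCutoff_le_one _ _ _

/-- `∇φ = 0` on the open ball `B(x, 1)`. [folklore] -/
theorem gradient_suppCutoff_eq_zero_of_lt {x y : (EuclideanSpace ℝ (Fin 3))} (hy : ‖y - x‖ < 1) :
    gradient (suppCutoff x 1) y = 0 := by
  rw [gradient, fderiv_suppCutoff_eq_zero one_pos hy, map_zero]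

/-- `∇φ = 0` off the closed ball `B̄(x, 2)`. [folklore] -/
theorem gradient_suppCutoff_eq_zero_of_two_lt {x y : (EuclideanSpace ℝ (Fin 3))} (hy : 2 < ‖y - x‖) :
    gradient (suppCutoff x 1) y = 0 := by
  have h : y ∉ tsupport (suppCutoff x 1) := by
    intro hmem
    have hsub : tsupport (suppCutoff x 1) ⊆ closedBall x 2 := by
      refine closure_minimal ?_ isClosed_closedBall
      intro z hz
      rw [mem_closedBall, dist_eq_norm]
      by_contra hz'
      exact hz (suppCutoff_eq_zero one_pos (by linarith [not_le.1 hz']))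
    have := hsub hmem
    rw [mem_closedBall, dist_eq_norm] at this
    linarith
  rw [gradient, fderiv_of_notMem_tsupport ℝ h, map_zero]

/-- **Uniform bound for `∇φ`**: there is `B ≥ 0` with `‖∇(suppCutoff x 1)(y)‖ ≤ B` for all `x, y`
(chain rule from the tree's uniform bound for the scaled radial cutoff). [folklore] -/
theorem exists_norm_gradient_suppCutoff_le :
    ∃ B : ℝ, 0 ≤ B ∧ ∀ x y : (EuclideanSpace ℝ (Fin 3)), ‖gradient (suppCutoff x 1) y‖ ≤ B := by
  obtain ⟨B, hB0, hB⟩ := exists_norm_fderiv_radialCutoff_le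
  refine ⟨B, hB0, fun x y => ?_⟩
  have hθ : ContDiff ℝ 1 (radialCutoff 1 (2 * 1) : (EuclideanSpace ℝ (Fin 3)) → ℝ) := radialCutoff_contDiff 1 (2 * 1)
  have hfun : suppCutoff x 1 = fun y : (EuclideanSpace ℝ (Fin 3)) => radialCutoff 1 (2 * 1) (y - x) := rfl
  have h1 : HasFDerivAt (fun y : (EuclideanSpace ℝ (Fin 3)) => y - x) (ContinuousLinearMap.id ℝ (EuclideanSpace ℝ (Fin 3))) y :=
    (hasFDerivAt_id y).sub_const x
  have hd : HasFDerivAt (fun y : (EuclideanSpace ℝ (Fin 3)) => radialCutoff 1 (2 * 1) (y - x))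
      ((fderiv ℝ (radialCutoff 1 (2 * 1) : (EuclideanSpace ℝ (Fin 3)) → ℝ) (y - x)).comp (ContinuousLinearMap.id ℝ (EuclideanSpace ℝ (Fin 3)))) y :=
    HasFDerivAt.comp y (g := (radialCutoff 1 (2 * 1) : (EuclideanSpace ℝ (Fin 3)) → ℝ))
      (((hθ.differentiable one_ne_zero) (y - x)).hasFDerivAt) h1
  rw [hfun, gradient, hd.fderiv, ContinuousLinearMap.comp_id, LinearIsometryEquiv.norm_map]
  simpa using hB 1 one_pos (y - x)

/-- The Biot–Savart integrand of a continuous compactly supported source is integrable. [folklore] -/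
theorem integrable_biotSavartKernel_sub_apply_of_hasCompactSupport {h : (EuclideanSpace ℝ (Fin 3)) → (EuclideanSpace ℝ (Fin 3))}
    (hh : Continuous h) (hhc : HasCompactSupport h) (x : (EuclideanSpace ℝ (Fin 3))) :
    Integrable fun y => biotSavartKernel (x - y) (h y) := by
  obtain ⟨M, hM⟩ := hh.bounded_above_of_compact_support hhc
  exact integrable_biotSavartKernel_sub_apply hh.measurable (hh.integrable_of_hasCompactSupport hhc)
    hM x

/-- Cauchy–Schwarz for `∫ k(x − y) g(y) dy` with nonnegative `k, g ∈ L²`. [folklore] -/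
theorem integral_mul_comp_sub_le_L2 {k g : (EuclideanSpace ℝ (Fin 3)) → ℝ} (hk0 : ∀ z, 0 ≤ k z) (hg0 : ∀ y, 0 ≤ g y)
    (hk : MemLp k (ENNReal.ofReal 2) volume) (hg : MemLp g (ENNReal.ofReal 2) volume) (x : (EuclideanSpace ℝ (Fin 3))) :
    ∫ y, k (x - y) * g y ≤ (∫ z, k z ^ (2 : ℝ)) ^ (1 / (2 : ℝ)) * (∫ y, g y ^ (2 : ℝ)) ^ (1 / (2 : ℝ)) := by
  have hkx : MemLp (fun y => k (x - y)) (ENNReal.ofReal 2) volume :=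
    hk.comp_measurePreserving (Measure.measurePreserving_sub_left volume x)
  have h := integral_mul_le_Lp_mul_Lq_of_nonneg Real.HolderConjugate.two_two
    (Eventually.of_forall fun y => hk0 (x - y)) (Eventually.of_forall hg0) hkx hg
  rwa [integral_sub_left_eq_self (fun z => k z ^ (2 : ℝ)) volume x] at h

/-- `(∫ g²)^{1/2} = ‖g‖_{L²}` for nonnegative `g ∈ L²`. [folklore] -/
theorem rpow_integral_sq_eq_toReal_eLpNorm {g : (EuclideanSpace ℝ (Fin 3)) → ℝ} (hg0 : ∀ y, 0 ≤ g y)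
    (hg : MemLp g (ENNReal.ofReal 2) volume) :
    (∫ y, g y ^ (2 : ℝ)) ^ (1 / (2 : ℝ)) = (eLpNorm g 2 volume).toReal := by
  have h2 : ENNReal.ofReal 2 = (2 : ℝ≥0∞) := by norm_num
  have h := MemLp.eLpNorm_eq_integral_rpow_norm (by norm_num) ENNReal.ofReal_ne_top hg
  rw [ENNReal.toReal_ofReal zero_le_two] at h
  rw [h2] at h
  rw [h, ENNReal.toReal_ofReal (by positivity), one_div]
  congr 1
  exact integral_congr_ae (Eventually.of_forall fun y => by simp [Real.norm_of_nonneg (hg0 y)])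

/-- The far kernel `1_{|z| ≥ 1} |z|⁻²` lies in `L²(ℝ³)`. [folklore] -/
theorem memLp_two_farKernel :
    MemLp (fun z : (EuclideanSpace ℝ (Fin 3)) => (ball (0 : (EuclideanSpace ℝ (Fin 3))) 1)ᶜ.indicator (fun z => (‖z‖ ^ 2)⁻¹) z)
      (ENNReal.ofReal 2) volume := by
  have hmeas : AEStronglyMeasurable
      (fun z : (EuclideanSpace ℝ (Fin 3)) => (ball (0 : (EuclideanSpace ℝ (Fin 3))) 1)ᶜ.indicator (fun z => (‖z‖ ^ 2)⁻¹) z) volume :=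
    (Measurable.indicator (measurable_norm.pow_const 2).inv measurableSet_ball.compl).aestronglyMeasurable
  rw [← integrable_norm_rpow_iff hmeas (by norm_num) ENNReal.ofReal_ne_top,
    ENNReal.toReal_ofReal (by norm_num)]
  have heq : (fun z : (EuclideanSpace ℝ (Fin 3)) => ‖(ball (0 : (EuclideanSpace ℝ (Fin 3))) 1)ᶜ.indicator (fun z => (‖z‖ ^ 2)⁻¹) z‖ ^ (2 : ℝ)) =
      (ball (0 : (EuclideanSpace ℝ (Fin 3))) 1)ᶜ.indicator fun z => ‖z‖ ^ (-(4 : ℝ)) := by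
    funext z
    by_cases hz : z ∈ (ball (0 : (EuclideanSpace ℝ (Fin 3))) 1)ᶜ
    · rw [indicator_of_mem hz, indicator_of_mem hz, Real.norm_of_nonneg (by positivity),
        ← Real.rpow_natCast, ← Real.rpow_neg (norm_nonneg z), ← Real.rpow_mul (norm_nonneg z)]
      norm_num
    · rw [indicator_of_notMem hz, indicator_of_notMem hz, norm_zero, Real.zero_rpow (by norm_num)]
  rw [heq, integrable_indicator_iff measurableSet_ball.compl]
  exact NewtonPotentialHolder.integrableOn_compl_ball_norm_rpow_neg (by norm_num) one_pos

/-- `∫_{B̄(x,2)} ‖v‖ ≤ |B̄₂|^{1/2} ‖v‖_{L²}` (Cauchy–Schwarz on a ball; the volume does not depend on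
the centre). [folklore] -/
theorem integral_indicator_closedBall_mul_norm_le {v : (EuclideanSpace ℝ (Fin 3)) → (EuclideanSpace ℝ (Fin 3))} (hvc : Continuous v)
    (hv2 : ∫⁻ y, ‖v y‖ₑ ^ 2 < ⊤) (x : (EuclideanSpace ℝ (Fin 3))) :
    ∫ y, (closedBall x 2).indicator (fun _ => (1 : ℝ)) y * ‖v y‖ ≤
      (volume (closedBall (0 : (EuclideanSpace ℝ (Fin 3))) 2)).toReal ^ (1 / (2 : ℝ)) * (eLpNorm v 2 volume).toReal := by
  have h2 : ENNReal.ofReal 2 = (2 : ℝ≥0∞) := by norm_num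
  have hf : MemLp (fun y => (closedBall x 2).indicator (fun _ => (1 : ℝ)) y) (ENNReal.ofReal 2) volume := by
    rw [h2]
    exact memLp_indicator_const 2 measurableSet_closedBall (1 : ℝ) (Or.inr measure_closedBall_lt_top.ne)
  have hg : MemLp (fun y => ‖v y‖) (ENNReal.ofReal 2) volume := by
    rw [h2, memLp_two_iff_integrable_sq_norm hvc.norm.aestronglyMeasurable]
    have h := integrable_sq_norm_of_lintegral_lt_top hvc hv2
    exact h.congr (Eventually.of_forall fun y => by simp)
  have h := integral_mul_le_Lp_mul_Lq_of_nonneg Real.HolderConjugate.two_two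
    (Eventually.of_forall fun y => indicator_nonneg (fun _ _ => zero_le_one) y)
    (Eventually.of_forall fun y => norm_nonneg (v y)) hf hg
  refine h.trans (le_of_eq ?_)
  congr 1
  · congr 1
    have heq : (fun y => (closedBall x 2).indicator (fun _ => (1 : ℝ)) y ^ (2 : ℝ)) =
        (closedBall x 2).indicator fun _ => (1 : ℝ) := by
      funext y
      by_cases hy : y ∈ closedBall x 2
      · rw [indicator_of_mem hy, Real.one_rpow]
      · rw [indicator_of_notMem hy, Real.zero_rpow (by norm_num)]
    rw [heq, integral_indicator_const _ measurableSet_closedBall, smul_eq_mul, mul_one,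
      measureReal_def, Measure.addHaar_closedBall_center volume x]
  · rw [rpow_integral_sq_eq_toReal_eLpNorm (fun y => norm_nonneg _) hg, eLpNorm_norm]

end Tools

/-! ### The sup bound -/

section SupBound

/-- `‖a × b‖ ≤ ‖a‖ ‖b‖`. [folklore] -/
theorem norm_cross_le_mul_norm (a b : (EuclideanSpace ℝ (Fin 3))) : ‖cross a b‖ ≤ ‖a‖ * ‖b‖ := by
  rw [norm_cross]
  have h1 : Real.sin (InnerProductGeometry.angle a b) ≤ 1 := Real.sin_le_one _
  have h0 : 0 ≤ ‖a‖ * ‖b‖ := by positivity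
  nlinarith
set_option maxHeartbeats 400000 in -- buildfix (bf3-g26): 160k/180k FAIL, 200k PASS at accept time; line-neutral budget line
/-- **Sup bound for the velocity generated by the low vorticity** (Constantin–Fefferman 1993, §2;
Lemarié-Rieusset 2016, proof of Thm. 11.7, the terms carrying `α = 1_{|ω|≤R}ω`). There are
absolute constants `C_b, C_v ≥ 0` such that: if `v ∈ C²(ℝ³; ℝ³) ∩ L²` is divergence free and
`curl v = a + b` with `‖a‖ ≤ Λ` everywhere and `b` continuous with compact support, then for
every `x`,
`‖v(x) − (K ∗ b)(x)‖ ≤ 2Λ + C_b ‖b‖_{L²} + C_v ‖v‖_{L²}`.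
Proof: the local Helmholtz identity `eq_biotSavart_curl_smul_add` with `curl(φv) = φa + φb + ∇φ × v`
gives `v(x) − (K∗b)(x) = K∗(φa)(x) + K∗((φ−1)b)(x) + K∗(∇φ×v)(x) + ∑ⱼ(∫∂ⱼΓ ⟪v,∇φ⟫)eⱼ`; the first
term is `≤ Λ(4π)⁻¹∫_{|z|<2}|z|⁻² = 2Λ`, the second is Cauchy–Schwarz against `1_{|z|≥1}|z|⁻² ∈ L²`,
and the last two live on the shell `1 ≤ |y − x| ≤ 2` where the kernels are bounded by `(4π)⁻¹`. [cite: LemarieRieusset2016, Thm. 11.7 (proof, PDF pp. 370–371); ConstantinFeffermanIndiana1993, §2] -/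
theorem exists_norm_sub_biotSavart_le :
    ∃ C_b C_v : ℝ, 0 ≤ C_b ∧ 0 ≤ C_v ∧ ∀ ⦃v : (EuclideanSpace ℝ (Fin 3)) → (EuclideanSpace ℝ (Fin 3))⦄ (_ : ContDiff ℝ 2 v)
      (_ : VectorCalculus.IsDivFree v) (_ : ∫⁻ y, ‖v y‖ₑ ^ 2 < ⊤)
      ⦃a b : (EuclideanSpace ℝ (Fin 3)) → (EuclideanSpace ℝ (Fin 3))⦄ (_ : ∀ y, curl v y = a y + b y) ⦃Λ : ℝ⦄ (_ : ∀ y, ‖a y‖ ≤ Λ)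
      (_ : Continuous b) (_ : HasCompactSupport b) (x : (EuclideanSpace ℝ (Fin 3))),
      ‖v x - biotSavart b x‖ ≤
        2 * Λ + C_b * (eLpNorm b 2 volume).toReal + C_v * (eLpNorm v 2 volume).toReal := by
  obtain ⟨B, hB0, hB⟩ := exists_norm_gradient_suppCutoff_le
  set kf : (EuclideanSpace ℝ (Fin 3)) → ℝ := fun z => (ball (0 : (EuclideanSpace ℝ (Fin 3))) 1)ᶜ.indicator (fun z => (‖z‖ ^ 2)⁻¹) z with hkf
  have hkf0 : ∀ z, 0 ≤ kf z := fun z => by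
    rw [hkf]; exact indicator_nonneg (fun _ _ => by positivity) z
  have hkf1 : ∀ z, kf z ≤ 1 := fun z => by
    show (ball (0 : (EuclideanSpace ℝ (Fin 3))) 1)ᶜ.indicator (fun z => (‖z‖ ^ 2)⁻¹) z ≤ 1
    by_cases hz : z ∈ (ball (0 : (EuclideanSpace ℝ (Fin 3))) 1)ᶜ
    · rw [indicator_of_mem hz]
      have hz1 : 1 ≤ ‖z‖ := by simpa using hz
      exact inv_le_one_of_one_le₀ (by nlinarith)
    · rw [indicator_of_notMem hz]; exact zero_le_one
  set Cf : ℝ := (∫ z, kf z ^ (2 : ℝ)) ^ (1 / (2 : ℝ)) with hCf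
  have hCf0 : 0 ≤ Cf := Real.rpow_nonneg (integral_nonneg fun z => Real.rpow_nonneg (hkf0 z) _) _
  set V2 : ℝ := (volume (closedBall (0 : (EuclideanSpace ℝ (Fin 3))) 2)).toReal ^ (1 / (2 : ℝ)) with hV2
  have hV20 : 0 ≤ V2 := Real.rpow_nonneg ENNReal.toReal_nonneg _
  refine ⟨(4 * π)⁻¹ * Cf, 4 * ((4 * π)⁻¹ * B * V2), by positivity, by positivity, ?_⟩
  intro v hv hdiv hv2 a b hab Λ hΛ hb hbc x
  have hΛ0 : 0 ≤ Λ := (norm_nonneg _).trans (hΛ x)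
  have hv1 : ContDiff ℝ 1 v := hv.of_le (by norm_num)
  have hvc : Continuous v := hv.continuous
  -- the cutoff and the identity
  set φ : (EuclideanSpace ℝ (Fin 3)) → ℝ := suppCutoff x 1 with hφdef
  have hφ1 : ContDiff ℝ 1 φ := contDiff_suppCutoff' x
  have hφc : HasCompactSupport φ := hasCompactSupport_suppCutoff x one_pos
  have hφcont : Continuous φ := hφ1.continuous
  have hgφ : Continuous (gradient φ) := (contDiff_gradient_suppCutoff x).continuous
  have hid := eq_biotSavart_curl_smul_add hv hdiv x
  -- `a` is continuous
  have ha : Continuous a := by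
    have : a = fun y => curl v y - b y := funext fun y => by rw [hab, add_sub_cancel_right]
    rw [this]
    exact (continuous_curl hv1).sub hb
  -- the three sources
  set s₁ : (EuclideanSpace ℝ (Fin 3)) → (EuclideanSpace ℝ (Fin 3)) := fun y => φ y • a y with hs₁
  set s₂ : (EuclideanSpace ℝ (Fin 3)) → (EuclideanSpace ℝ (Fin 3)) := fun y => (φ y - 1) • b y with hs₂
  set s₃ : (EuclideanSpace ℝ (Fin 3)) → (EuclideanSpace ℝ (Fin 3)) := fun y => cross (gradient φ y) (v y) with hs₃
  have hs₁c : Continuous s₁ := hφcont.smul ha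
  have hs₂c : Continuous s₂ := (hφcont.sub continuous_const).smul hb
  have hs₃c : Continuous s₃ := by
    show Continuous fun y => crossCLM (gradient φ y) (v y)
    exact crossCLM.continuous₂.comp (hgφ.prodMk hvc)
  have hs₁s : HasCompactSupport s₁ := by
    show HasCompactSupport (φ • a)
    exact hφc.smul_right
  have hs₂s : HasCompactSupport s₂ := by
    show HasCompactSupport ((fun y => φ y - 1) • b)
    exact hbc.smul_left
  have hs₃s : HasCompactSupport s₃ := by
    refine (hasCompactSupport_gradient_suppCutoff x).mono ?_
    intro y hy
    rw [mem_support] at hy ⊢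
    intro h
    apply hy
    show cross (gradient φ y) (v y) = 0
    rw [hφdef, h, ← crossCLM_apply, map_zero, zero_apply]
  -- the curl of the localised field
  have hcurlW : ∀ y, curl (fun y => suppCutoff x 1 y • v y) y - b y = s₁ y + s₂ y + s₃ y := by
    intro y
    rw [curl_smul ((hφ1.differentiable one_ne_zero) y) ((hv1.differentiable one_ne_zero) y),
      fderiv_eq_innerSL_gradient, curlCLM_smulRight_innerSL, hab, smul_add, hs₁, hs₂, hs₃]
    simp only [sub_smul, one_smul, hφdef]
    abel
  -- integrability of the four Biot–Savart integrands
  have I₁ := integrable_biotSavartKernel_sub_apply_of_hasCompactSupport hs₁c hs₁s x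
  have I₂ := integrable_biotSavartKernel_sub_apply_of_hasCompactSupport hs₂c hs₂s x
  have I₃ := integrable_biotSavartKernel_sub_apply_of_hasCompactSupport hs₃c hs₃s x
  have Ib := integrable_biotSavartKernel_sub_apply_of_hasCompactSupport hb hbc x
  have hWs : HasCompactSupport ((suppCutoff x 1) • v) := hφc.smul_right
  have IW : Integrable fun y => biotSavartKernel (x - y) (curl (fun y => suppCutoff x 1 y • v y) y) :=
    integrable_biotSavartKernel_sub_apply_of_hasCompactSupport
      (continuous_curl (hφ1.smul hv1)) (hasCompactSupport_curl hWs) x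
  have he1 : ∀ j : Fin 3, ‖(EuclideanSpace.single (j : Fin 3) (1 : ℝ))‖ = 1 := fun j => by simp
  -- the decomposition of `v x − biotSavart b x`
  have hdec : v x - biotSavart b x =
      (∫ y, biotSavartKernel (x - y) (s₁ y)) + (∫ y, biotSavartKernel (x - y) (s₂ y)) +
        (∫ y, biotSavartKernel (x - y) (s₃ y)) +
        ∑ j, (∫ y, fderiv ℝ newtonKernel (x - y) (EuclideanSpace.single (j : Fin 3) (1 : ℝ)) *
          ⟪v y, gradient (suppCutoff x 1) y⟫) • (EuclideanSpace.single (j : Fin 3) (1 : ℝ)) := by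
    have hdiff : biotSavart (curl fun y => suppCutoff x 1 y • v y) x - biotSavart b x =
        (∫ y, biotSavartKernel (x - y) (s₁ y)) + (∫ y, biotSavartKernel (x - y) (s₂ y)) +
          ∫ y, biotSavartKernel (x - y) (s₃ y) := by
      have hI12 : Integrable (fun y => biotSavartKernel (x - y) (s₁ y) + biotSavartKernel (x - y) (s₂ y)) :=
        I₁.add I₂
      rw [biotSavart, biotSavart, ← integral_sub IW Ib, ← integral_add I₁ I₂, ← integral_add hI12 I₃]
      refine integral_congr_ae (Eventually.of_forall fun y => ?_)
      show biotSavartKernel (x - y) (curl (fun y => suppCutoff x 1 y • v y) y) - biotSavartKernel (x - y) (b y) =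
        biotSavartKernel (x - y) (s₁ y) + biotSavartKernel (x - y) (s₂ y) + biotSavartKernel (x - y) (s₃ y)
      rw [← biotSavartCLM_apply, ← biotSavartCLM_apply, ← biotSavartCLM_apply, ← biotSavartCLM_apply,
        ← biotSavartCLM_apply, ← map_sub, hcurlW, map_add, map_add]
    conv_lhs => rw [hid]
    rw [← hdiff]
    abel
  -- the common shell majorant for the cutoff terms
  set g₃ : (EuclideanSpace ℝ (Fin 3)) → ℝ := fun y => (4 * π)⁻¹ * B * ((closedBall x 2).indicator (fun _ => (1 : ℝ)) y * ‖v y‖)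
    with hg₃
  have hg₃i : Integrable g₃ := by
    have h1 : Integrable ((closedBall x 2).indicator fun y => ‖v y‖) := by
      rw [integrable_indicator_iff measurableSet_closedBall]
      exact hvc.norm.continuousOn.integrableOn_compact (isCompact_closedBall x 2)
    refine (h1.const_mul ((4 * π)⁻¹ * B)).congr (Eventually.of_forall fun y => ?_)
    show (4 * π)⁻¹ * B * (closedBall x 2).indicator (fun y => ‖v y‖) y = g₃ y
    rw [hg₃]
    by_cases hy : y ∈ closedBall x 2
    · simp only [indicator_of_mem hy, one_mul]
    · simp only [indicator_of_notMem hy, zero_mul]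
  have hg₃int : ∫ y, g₃ y ≤ (4 * π)⁻¹ * B * V2 * (eLpNorm v 2 volume).toReal := by
    rw [hg₃, integral_const_mul, mul_assoc ((4 * π)⁻¹ * B)]
    exact mul_le_mul_of_nonneg_left (integral_indicator_closedBall_mul_norm_le hvc hv2 x) (by positivity)
  -- pointwise facts on the shell
  have hshell : ∀ y, ‖gradient φ y‖ * (‖x - y‖ ^ 2)⁻¹ ≤
      B * (closedBall x 2).indicator (fun _ => (1 : ℝ)) y := by
    intro y
    by_cases h1 : ‖y - x‖ < 1
    · rw [hφdef, gradient_suppCutoff_eq_zero_of_lt h1, norm_zero, zero_mul]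
      exact mul_nonneg hB0 (indicator_nonneg (fun _ _ => zero_le_one) y)
    by_cases h2 : 2 < ‖y - x‖
    · rw [hφdef, gradient_suppCutoff_eq_zero_of_two_lt h2, norm_zero, zero_mul]
      exact mul_nonneg hB0 (indicator_nonneg (fun _ _ => zero_le_one) y)
    · have hy2 : y ∈ closedBall x 2 := by
        rw [mem_closedBall, dist_eq_norm]; exact not_lt.1 h2
      rw [indicator_of_mem hy2, mul_one]
      have hxy : 1 ≤ ‖x - y‖ := by rw [norm_sub_rev]; exact not_lt.1 h1
      have hinv : (‖x - y‖ ^ 2)⁻¹ ≤ 1 := inv_le_one_of_one_le₀ (by nlinarith)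
      calc ‖gradient φ y‖ * (‖x - y‖ ^ 2)⁻¹ ≤ B * 1 :=
            mul_le_mul (hB x y) hinv (by positivity) hB0
        _ = B := mul_one B
  -- bound 1: the near field of the bounded part
  have hb1 : ‖∫ y, biotSavartKernel (x - y) (s₁ y)‖ ≤ 2 * Λ := by
    have hmaj : Integrable fun y => (4 * π)⁻¹ * Λ * kernelMajorant 2 (x - y) :=
      ((integrable_kernelMajorant 2).comp_sub_left x).const_mul _
    have hpt : ∀ y, ‖biotSavartKernel (x - y) (s₁ y)‖ ≤ (4 * π)⁻¹ * Λ * kernelMajorant 2 (x - y) := by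
      intro y
      by_cases hy : ‖y - x‖ < 2
      · have hmem : x - y ∈ ball (0 : (EuclideanSpace ℝ (Fin 3))) 2 := by
          rw [mem_ball_zero_iff, norm_sub_rev]; exact hy
        rw [kernelMajorant, indicator_of_mem hmem]
        calc ‖biotSavartKernel (x - y) (s₁ y)‖ ≤ (4 * π)⁻¹ * ‖s₁ y‖ * (‖x - y‖ ^ 2)⁻¹ :=
              norm_biotSavartKernel_le _ _
          _ ≤ (4 * π)⁻¹ * Λ * (‖x - y‖ ^ 2)⁻¹ := by
              gcongr
              rw [hs₁, norm_smul, Real.norm_eq_abs]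
              calc |φ y| * ‖a y‖ ≤ 1 * Λ :=
                    mul_le_mul (abs_suppCutoff_le_one x 1 y) (hΛ y) (norm_nonneg _) zero_le_one
                _ = Λ := one_mul Λ
      · have h0 : s₁ y = 0 := by
          rw [hs₁]
          show φ y • a y = 0
          rw [hφdef, suppCutoff_eq_zero one_pos (by linarith [not_lt.1 hy]), zero_smul]
        rw [h0, biotSavartKernel_zero_right, norm_zero]
        exact mul_nonneg (by positivity) (kernelMajorant_nonneg _ _)
    refine (norm_integral_le_of_norm_le hmaj (Eventually.of_forall hpt)).trans (le_of_eq ?_)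
    rw [integral_const_mul, integral_sub_left_eq_self (kernelMajorant 2) volume x,
      integral_kernelMajorant zero_le_two]
    field_simp
  -- bound 2: the far field of the compactly supported part
  have hb2 : ‖∫ y, biotSavartKernel (x - y) (s₂ y)‖ ≤ (4 * π)⁻¹ * Cf * (eLpNorm b 2 volume).toReal := by
    have hbn : Integrable fun y => ‖b y‖ := (hb.integrable_of_hasCompactSupport hbc).norm
    have hmajm : AEStronglyMeasurable (fun y => (4 * π)⁻¹ * (kf (x - y) * ‖b y‖)) volume := by
      refine (Measurable.const_mul ((Measurable.mul ?_ hb.measurable.norm)) _).aestronglyMeasurable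
      exact (Measurable.indicator (measurable_norm.pow_const 2).inv measurableSet_ball.compl).comp
        (measurable_const.sub measurable_id)
    have hmaj : Integrable fun y => (4 * π)⁻¹ * (kf (x - y) * ‖b y‖) := by
      refine (hbn.const_mul (4 * π)⁻¹).mono' hmajm (Eventually.of_forall fun y => ?_)
      rw [Real.norm_of_nonneg (mul_nonneg (by positivity) (mul_nonneg (hkf0 _) (norm_nonneg _)))]
      refine mul_le_mul_of_nonneg_left ?_ (by positivity)
      exact mul_le_of_le_one_left (norm_nonneg _) (hkf1 _)
    have hpt : ∀ y, ‖biotSavartKernel (x - y) (s₂ y)‖ ≤ (4 * π)⁻¹ * (kf (x - y) * ‖b y‖) := by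
      intro y
      by_cases hy : ‖y - x‖ ≤ 1
      · have h0 : s₂ y = 0 := by
          rw [hs₂]
          show (φ y - 1) • b y = 0
          rw [hφdef, suppCutoff_eq_one one_pos hy, sub_self, zero_smul]
        rw [h0, biotSavartKernel_zero_right, norm_zero]
        exact mul_nonneg (by positivity) (mul_nonneg (hkf0 _) (norm_nonneg _))
      · have hmem : x - y ∈ (ball (0 : (EuclideanSpace ℝ (Fin 3))) 1)ᶜ := by
          intro h
          rw [mem_ball_zero_iff, norm_sub_rev] at h
          exact hy h.le
        have hkfy : kf (x - y) = (‖x - y‖ ^ 2)⁻¹ := by rw [hkf]; exact indicator_of_mem hmem _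
        rw [hkfy]
        calc ‖biotSavartKernel (x - y) (s₂ y)‖ ≤ (4 * π)⁻¹ * ‖s₂ y‖ * (‖x - y‖ ^ 2)⁻¹ :=
              norm_biotSavartKernel_le _ _
          _ ≤ (4 * π)⁻¹ * ‖b y‖ * (‖x - y‖ ^ 2)⁻¹ := by
              gcongr
              rw [hs₂, norm_smul, Real.norm_eq_abs]
              refine mul_le_of_le_one_left (norm_nonneg _) ?_
              rw [abs_sub_le_iff]
              exact ⟨by linarith [suppCutoff_le_one x 1 y, suppCutoff_nonneg x 1 y],
                by linarith [suppCutoff_le_one x 1 y, suppCutoff_nonneg x 1 y]⟩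
          _ = (4 * π)⁻¹ * ((‖x - y‖ ^ 2)⁻¹ * ‖b y‖) := by ring
    refine (norm_integral_le_of_norm_le hmaj (Eventually.of_forall hpt)).trans ?_
    rw [integral_const_mul, mul_assoc]
    refine mul_le_mul_of_nonneg_left ?_ (by positivity)
    have hb2m : MemLp (fun y => ‖b y‖) (ENNReal.ofReal 2) volume :=
      (hb.norm.memLp_of_hasCompactSupport hbc.norm)
    have h := integral_mul_comp_sub_le_L2 hkf0 (fun y => norm_nonneg (b y)) memLp_two_farKernel hb2m x
    rw [rpow_integral_sq_eq_toReal_eLpNorm (fun y => norm_nonneg (b y)) hb2m, eLpNorm_norm] at h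
    exact h
  -- bound 3: the cutoff term of the curl
  have hb3 : ‖∫ y, biotSavartKernel (x - y) (s₃ y)‖ ≤ (4 * π)⁻¹ * B * V2 * (eLpNorm v 2 volume).toReal := by
    have hpt : ∀ y, ‖biotSavartKernel (x - y) (s₃ y)‖ ≤ g₃ y := by
      intro y
      calc ‖biotSavartKernel (x - y) (s₃ y)‖ ≤ (4 * π)⁻¹ * ‖s₃ y‖ * (‖x - y‖ ^ 2)⁻¹ :=
            norm_biotSavartKernel_le _ _
        _ ≤ (4 * π)⁻¹ * (‖gradient φ y‖ * ‖v y‖) * (‖x - y‖ ^ 2)⁻¹ := by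
            gcongr
            exact norm_cross_le_mul_norm _ _
        _ = (4 * π)⁻¹ * ((‖gradient φ y‖ * (‖x - y‖ ^ 2)⁻¹) * ‖v y‖) := by ring
        _ ≤ (4 * π)⁻¹ * ((B * (closedBall x 2).indicator (fun _ => (1 : ℝ)) y) * ‖v y‖) :=
            mul_le_mul_of_nonneg_left (mul_le_mul_of_nonneg_right (hshell y) (norm_nonneg _))
              (by positivity)
        _ = g₃ y := by rw [hg₃]; ring
    exact (norm_integral_le_of_norm_le hg₃i (Eventually.of_forall hpt)).trans hg₃int
  -- bound 4: the gradient (pressure-like) term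
  have hb4 : ‖∑ j, (∫ y, fderiv ℝ newtonKernel (x - y) (EuclideanSpace.single (j : Fin 3) (1 : ℝ)) *
      ⟪v y, gradient (suppCutoff x 1) y⟫) • (EuclideanSpace.single (j : Fin 3) (1 : ℝ))‖ ≤
      3 * ((4 * π)⁻¹ * B * V2 * (eLpNorm v 2 volume).toReal) := by
    have hcoef : ∀ j : Fin 3, |∫ y, fderiv ℝ newtonKernel (x - y) (EuclideanSpace.single (j : Fin 3) (1 : ℝ)) *
        ⟪v y, gradient (suppCutoff x 1) y⟫| ≤ (4 * π)⁻¹ * B * V2 * (eLpNorm v 2 volume).toReal := by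
      intro j
      have hpt : ∀ y, ‖fderiv ℝ newtonKernel (x - y) (EuclideanSpace.single (j : Fin 3) (1 : ℝ)) * ⟪v y, gradient (suppCutoff x 1) y⟫‖ ≤
          g₃ y := by
        intro y
        rw [norm_mul, Real.norm_eq_abs, Real.norm_eq_abs]
        have h1 : |fderiv ℝ newtonKernel (x - y) (EuclideanSpace.single (j : Fin 3) (1 : ℝ))| ≤ (4 * π * ‖x - y‖ ^ 2)⁻¹ := by
          calc |fderiv ℝ newtonKernel (x - y) (EuclideanSpace.single (j : Fin 3) (1 : ℝ))| = ‖fderiv ℝ newtonKernel (x - y) (EuclideanSpace.single (j : Fin 3) (1 : ℝ))‖ :=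
                (Real.norm_eq_abs _).symm
            _ ≤ ‖fderiv ℝ newtonKernel (x - y)‖ * ‖(EuclideanSpace.single (j : Fin 3) (1 : ℝ))‖ := ContinuousLinearMap.le_opNorm _ _
            _ ≤ (4 * π * ‖x - y‖ ^ 2)⁻¹ * 1 := by
                gcongr
                · exact norm_fderiv_newtonKernel_le _
                · rw [he1 j]
            _ = (4 * π * ‖x - y‖ ^ 2)⁻¹ := mul_one _
        have h2 : |⟪v y, gradient (suppCutoff x 1) y⟫| ≤ ‖v y‖ * ‖gradient φ y‖ := by
          rw [hφdef]; exact abs_real_inner_le_norm _ _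
        calc |fderiv ℝ newtonKernel (x - y) (EuclideanSpace.single (j : Fin 3) (1 : ℝ))| * |⟪v y, gradient (suppCutoff x 1) y⟫|
            ≤ (4 * π * ‖x - y‖ ^ 2)⁻¹ * (‖v y‖ * ‖gradient φ y‖) :=
              mul_le_mul h1 h2 (abs_nonneg _) (by positivity)
          _ = (4 * π)⁻¹ * ((‖gradient φ y‖ * (‖x - y‖ ^ 2)⁻¹) * ‖v y‖) := by
              rw [mul_inv]; ring
          _ ≤ (4 * π)⁻¹ * ((B * (closedBall x 2).indicator (fun _ => (1 : ℝ)) y) * ‖v y‖) :=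
              mul_le_mul_of_nonneg_left (mul_le_mul_of_nonneg_right (hshell y) (norm_nonneg _))
                (by positivity)
          _ = g₃ y := by rw [hg₃]; ring
      have h := norm_integral_le_of_norm_le hg₃i (Eventually.of_forall hpt)
      rw [Real.norm_eq_abs] at h
      exact h.trans hg₃int
    calc ‖∑ j, (∫ y, fderiv ℝ newtonKernel (x - y) (EuclideanSpace.single (j : Fin 3) (1 : ℝ)) *
          ⟪v y, gradient (suppCutoff x 1) y⟫) • (EuclideanSpace.single (j : Fin 3) (1 : ℝ))‖
        ≤ ∑ j, ‖(∫ y, fderiv ℝ newtonKernel (x - y) (EuclideanSpace.single (j : Fin 3) (1 : ℝ)) *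
          ⟪v y, gradient (suppCutoff x 1) y⟫) • (EuclideanSpace.single (j : Fin 3) (1 : ℝ))‖ := norm_sum_le _ _
      _ = ∑ j, |∫ y, fderiv ℝ newtonKernel (x - y) (EuclideanSpace.single (j : Fin 3) (1 : ℝ)) * ⟪v y, gradient (suppCutoff x 1) y⟫| := by
          refine Finset.sum_congr rfl fun j _ => ?_
          rw [norm_smul, Real.norm_eq_abs, he1 j, mul_one]
      _ ≤ ∑ _j : Fin 3, (4 * π)⁻¹ * B * V2 * (eLpNorm v 2 volume).toReal :=
          Finset.sum_le_sum fun j _ => hcoef j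
      _ = 3 * ((4 * π)⁻¹ * B * V2 * (eLpNorm v 2 volume).toReal) := by
          rw [Finset.sum_const, Finset.card_univ, Fintype.card_fin]
          simp
  -- assemble
  rw [hdec]
  have e1 := norm_add_le ((∫ y, biotSavartKernel (x - y) (s₁ y)) + (∫ y, biotSavartKernel (x - y) (s₂ y)) +
      (∫ y, biotSavartKernel (x - y) (s₃ y)))
    (∑ j, (∫ y, fderiv ℝ newtonKernel (x - y) (EuclideanSpace.single (j : Fin 3) (1 : ℝ)) * ⟪v y, gradient (suppCutoff x 1) y⟫) • (EuclideanSpace.single (j : Fin 3) (1 : ℝ)))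
  have e2 := norm_add_le ((∫ y, biotSavartKernel (x - y) (s₁ y)) + (∫ y, biotSavartKernel (x - y) (s₂ y)))
    (∫ y, biotSavartKernel (x - y) (s₃ y))
  have e3 := norm_add_le (∫ y, biotSavartKernel (x - y) (s₁ y)) (∫ y, biotSavartKernel (x - y) (s₂ y))
  linarith [e1, e2, e3, hb1, hb2, hb3, hb4]

end SupBound

end Literature.Analysis.FluidPDE

end
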